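/-
Origin: expansion seat `prover-pub-hodgecm-mc-binder-2-g11-0`, handover #36 2026-08-20T02:20Z md5 2b7011081499 (270 l.; CERTIFIED rc 0 / 0 warn / 21.6 s; imports #35 + RUN-37 #16 `IotaDictionary`; §1 `dpIdxCongr_refl_apply`, `cmIdx_apply`/`cmIdx_eq_pairFrame` (the canonical block index IS the pair frame), `posReadingEquiv`, **`torusPlaceLetter_eq_iotaTorusLetter`** (W read positive at v: my letter = #16's `iotaTorusLetter`); §2 **`linSubst_torusLetter_placePoly_vacuum_iota`** (at a W-positive ι₁ place with datum `iota jI`, `pairFrame ∘ jI = planeToDPIdx eA eR q₀`: the inserted `det z` is a letter eigenvector, eigenvalue `c₀c₁ = ι_{w₁}(u₀)ι_{w₁}(u₁)`); §3 the S-READING TWIN (not in #16): `planeToDPIdxS` (`z ↦ P×S`, `w ↦ Q×S`), `iotaTorusLetterS`, `linSubst_star_dualPairι_iotaS_rename_z/_detZ` (eigenvalue `conj(t₁t₂)`), `negReadingEquiv`, `torusPlaceLetter_eq_iotaTorusLetterS`, **`linSubst_torusLetter_placePoly_vacuum_iota_neg`**; NAME LIST `HodgeCM.Model.HypCensus.linSubst_torusLetter_placePoly_vacuum_iota`,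 `HodgeCM.Model.HypCensus.linSubst_torusLetter_placePoly_vacuum_iota_neg`, `HodgeCM.Model.HypCensus.cmIdx_eq_pairFrame`; axioms trio) (`HOME/mc/pub-hodgecm-mc-binder-2/g11/pkg/HodgeCM/Model/HypCensus/OmgInsIota.lean`, md5 2b7011081499, 270 lines);
landed by the gen-14 packager (p-g14) in gate run 39 as `HodgeCM/Model/HypCensus/OmgInsIota.lean` (verbatim).
-/
/-
Origin: speedrun cell pub-hodgecm, MODEL-CONSTRUCTION sub-cell, lineage mc-binder-2 (BINDER-OWNERS rows 18/19: E binders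
`hyp12` / `hyp34` of `Model.perL_picardCM_r15A`), seat prover-pub-hodgecm-mc-binder-2-g11-0 (gen 11), 2026-08-20.
Target in PKG: `HodgeCM/Model/HypCensus/OmgInsIota.lean` (NEW additive leaf; imports this lineage's `HypCensus/OmgInsVacuum` (gen 11) and the
RUN-37 INSTALLED `HypCensus/IotaDictionary` (#16)).
KERNEL ONLY: 0 records, nothing cited as hypothesis, 0 `def … : Prop`; theorems only.
-/
import Summits.HodgeConjecture.HodgeCM.Model.HypCensus.OmgInsVacuum
import Summits.HodgeConjecture.HodgeCM.Model.HypCensus.IotaDictionary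

/-!
# Census kit (rows A12/A34), junction (J-T12) at `φ₀`: the `ι₁` eigen-equation (`W` read POSITIVE at `ι₁`)

`OmgInsVacuum.cmPairRepTwist_torus_ins_vacuum` leaves ONE per-place input: at the place of kind `ι₁` the inserted printed vacuum `det z` must be
an eigenvector of the torus letter.  #16 `IotaDictionary.linSubst_star_dualPairι_iota_rename_detZ` is exactly that in Konno–Konno's block index
for the letter `iotaTorusLetter eR t = ((1,1),(diag(t₁,t₂),1))` (the `R`-READING: `W_{ι₁}` read positive, `S = ∅`).  This leaf transports it to
the census currency:

* §1 `cmIdx_apply` — the canonical block index IS the pair frame (`dpIdxCongr refl⁴ = id`); `torusPlaceLetter_eq_iotaTorusLetter` — when `W`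
  reads positive at `v` (`∀ j, 0 < x_W j`) the torus letter of `TorusLetters` IS #16's `iotaTorusLetter` along `eR := (subtypeUnivEquiv hR)⁻¹`,
  `t := (c₀, c₁)`.
* §2 **`linSubst_torusLetter_placePoly_vacuum_iota`**: for a datum family with `datum b₁ = iota jI` at the place `v₁` of `ι₁` and the variable
  identification `jI = (pairFrame v₁)⁻¹ ∘ planeToDPIdx eA eR q₀` (the CORRECT insertion of `det z`: `z_{aj} ↦ (V⁺_a, W_j)`, `w_j ↦ (V⁻, W_j)`), the
  vacuum place polynomial at `v₁` is a letter eigenvector with eigenvalue `c₀ c₁ = ι_{w₁}(u₀) ι_{w₁}(u₁)` — the hypothesis `hdι` of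
  `cmPairRepTwist_torus_ins_vacuum` at `v₁`, `d v₁ = c₀ c₁`.

The `S`-reading (`W_{ι₁}` read negative: `R = ∅`, variables in the blocks `P×S`/`Q×S`, eigenvalue `conj(c₀c₁)`) needs the twin of #16 §1–§2 with
`S` in place of `R`; successor.  Nothing here is a claim of PerL/QW8.  Style lint (L-notation): no `local notation`.
-/

set_option autoImplicit false

noncomputable section

open NumberField NumberField.InfinitePlace IsDedekindDomain
open scoped Matrix Kronecker Classical TensorProduct ComplexConjugate
open MvPolynomial
open Literature.NumberTheory.Automorphic Literature.NumberTheory.Automorphic.UnitaryGroup Literature.NumberTheory.Weil1964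
open Literature.RepresentationTheory.HeisenbergGroup (polar symplecticGroup)
open Literature.RepresentationTheory.KonnoKonno2007 Literature.RepresentationTheory.KonnoKonno2007.RealDualPair
open Literature.NumberTheory.GelbartRogawski1991 Literature.NumberTheory.GelbartRogawski1991.UnitaryDualPair
open Literature.RepresentationTheory (atPlace)
open Literature.Analysis.SegalBargmann
open HodgeCM.PerL34.Fock HodgeCM.PerL34.Fock.PrintDict

namespace HodgeCM.Model.HypCensus

section Iota

variable (L : Type) [Field L] [NumberField L] [IsCMField L]
variable (dV : Fin 3 → L) (hdV : ∀ i, IsCMField.complexConj L (dV i) = dV i) (hdV0 : ∀ i, dV i ≠ 0)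
variable (dW : Fin 2 → L) (hdW : ∀ i, IsCMField.complexConj L (dW i) = dW i) (hdW0 : ∀ i, dW i ≠ 0)
variable (ι₁ : L →+* ℂ)

/-! ## §1 Index and letter adapters -/

/-- the four-fold relabelling along identities is the identity. -/
theorem dpIdxCongr_refl_apply {P Q R S : Type} (x : DPIdx P Q R S) :
    dpIdxCongr P Q R S P Q R S (Equiv.refl P) (Equiv.refl Q) (Equiv.refl R) (Equiv.refl S) x = x := by
  rcases x with ((⟨p, r⟩ | ⟨q, s⟩) | (⟨p, s⟩ | ⟨q, r⟩)) <;> rfl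

/-- **the canonical block index of a place IS the pair frame** (`cmIdx v = pairFrame …`, pointwise). -/
theorem cmIdx_apply (v : {v : InfinitePlace ↥(maximalRealSubfield L) // v.IsReal}) (i : Fin 6) :
    cmIdx L dV hdV dW hdW ι₁ v i =
      pairFrame (PosIdx (cmXV L dV hdV ι₁ v)) (NegIdx (cmXV L dV hdV ι₁ v)) (PosIdx (cmXW L dV dW hdW ι₁ v))
        (NegIdx (cmXW L dV dW hdW ι₁ v)) finProdFinEquiv (cmEpsV L dV hdV ι₁ v) (cmEpsW L dV dW hdW ι₁ v) i :=
  dpIdxCongr_refl_apply _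

/-- (Ported verbatim from the HodgeCMPerL package; no docstring in the source.) -/
theorem cmIdx_eq_pairFrame (v : {v : InfinitePlace ↥(maximalRealSubfield L) // v.IsReal}) :
    (cmIdx L dV hdV dW hdW ι₁ v : Fin 6 ≃ _) =
      pairFrame (PosIdx (cmXV L dV hdV ι₁ v)) (NegIdx (cmXV L dV hdV ι₁ v)) (PosIdx (cmXW L dV dW hdW ι₁ v))
        (NegIdx (cmXW L dV dW hdW ι₁ v)) finProdFinEquiv (cmEpsV L dV hdV ι₁ v) (cmEpsW L dV dW hdW ι₁ v) :=
  Equiv.ext (cmIdx_apply L dV hdV dW hdW ι₁ v)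

/-- the frame `Fin 2 ≃ R_v` of a `W`-POSITIVE reading (`∀ j, 0 < x_W j`). -/
def posReadingEquiv {x : Fin 2 → ℝ} (hR : ∀ j, 0 < x j) : Fin 2 ≃ PosIdx x := (Equiv.subtypeUnivEquiv hR).symm

/-- (Ported verbatim from the HodgeCMPerL package; no docstring in the source.) -/
@[simp] theorem coe_posReadingEquiv_apply {x : Fin 2 → ℝ} (hR : ∀ j, 0 < x j) (j : Fin 2) :
    ((posReadingEquiv hR j : PosIdx x) : Fin 2) = j := rfl

/-- (Ported verbatim from the HodgeCMPerL package; no docstring in the source.) -/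
@[simp] theorem posReadingEquiv_symm_apply {x : Fin 2 → ℝ} (hR : ∀ j, 0 < x j) (r : PosIdx x) :
    (posReadingEquiv hR).symm r = r.1 := rfl

/-- **letter adapter**: when `W` reads positive at `v`, the torus letter of `TorusLetters` IS #16's `iotaTorusLetter` along
`eR := posReadingEquiv hR`, `t := (c₀, c₁)`, `c = torusPlaceCircles v u`. -/
theorem torusPlaceLetter_eq_iotaTorusLetter (v : {v : InfinitePlace ↥(maximalRealSubfield L) // v.IsReal})
    (hR : ∀ j, 0 < cmXW L dV dW hdW ι₁ v j) (u : SeesawArchTorus L) :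
    torusPlaceLetter L dV hdV dW hdW ι₁ v u =
      iotaTorusLetter (P' := PosIdx (cmXV L dV hdV ι₁ v)) (Q' := NegIdx (cmXV L dV hdV ι₁ v)) (S' := NegIdx (cmXW L dV dW hdW ι₁ v))
        (posReadingEquiv hR) (torusPlaceCircles L v u 0, torusPlaceCircles L v u 1) := by
  haveI : IsEmpty (NegIdx (cmXW L dV dW hdW ι₁ v)) := ⟨fun s => s.2 (hR s.1)⟩
  refine Prod.ext (torusPlaceLetter_fst L dV hdV dW hdW ι₁ v u) (Prod.ext ?_ (Subsingleton.elim _ _))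
  rw [torusPlaceLetter_snd]
  apply Subtype.ext
  rw [coe_diagHom]
  change _ = ((diagCircleUnitary (posReadingEquiv hR) (torusPlaceCircles L v u 0, torusPlaceCircles L v u 1) :
      Matrix.unitaryGroup (PosIdx (cmXW L dV dW hdW ι₁ v)) ℂ) :
        Matrix (PosIdx (cmXW L dV dW hdW ι₁ v)) (PosIdx (cmXW L dV dW hdW ι₁ v)) ℂ)
  rw [coe_diagCircleUnitary]
  congr 1
  funext r
  rw [circleRestrict_apply, posReadingEquiv_symm_apply]
  rcases r with ⟨r, hr⟩
  fin_cases r <;> rfl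

/-! ## §2 The `ι₁` eigen-equation of the inserted printed vacuum -/

variable (datum : ∀ b : InfinitePlace L, PlaceDatum L dV hdV dW hdW ι₁ (cmPlacesEquiv L b)) (m₁ m₂ : InfinitePlace L → ℤ)

/-- **the inserted `det z` at a `W`-positive `ι₁` place is a torus-letter eigenvector with eigenvalue `c₀ c₁`**, provided the datum there
is `iota jI` with the CORRECT variable identification `jI = (pairFrame v₁)⁻¹ ∘ planeToDPIdx eA eR q₀` (`z_{aj} ↦ (V⁺_a, W_j)`, `w_j ↦ (V⁻, W_j)`). -/
theorem linSubst_torusLetter_placePoly_vacuum_iota (v₁ : {v : InfinitePlace ↥(maximalRealSubfield L) // v.IsReal})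
    (hR : ∀ j, 0 < cmXW L dV dW hdW ι₁ v₁ j) (eA : Fin 2 ≃ PosIdx (cmXV L dV hdV ι₁ v₁)) (q₀ : NegIdx (cmXV L dV hdV ι₁ v₁))
    (jI : HodgeCM.PerL34.Fock.PlaneVar → Fin 6)
    (hjI : ∀ x, pairFrame (PosIdx (cmXV L dV hdV ι₁ v₁)) (NegIdx (cmXV L dV hdV ι₁ v₁)) (PosIdx (cmXW L dV dW hdW ι₁ v₁))
        (NegIdx (cmXW L dV dW hdW ι₁ v₁)) finProdFinEquiv (cmEpsV L dV hdV ι₁ v₁) (cmEpsW L dV dW hdW ι₁ v₁) (jI x) =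
      planeToDPIdx eA (posReadingEquiv hR) q₀ (NegIdx (cmXW L dV dW hdW ι₁ v₁)) x)
    (hι : datum ((cmPlacesEquiv L).symm v₁) = PlaceDatum.iota jI) (u : SeesawArchTorus L) :
    linSubst (star ((reindexUnitary (pairFrame (PosIdx (cmXV L dV hdV ι₁ v₁)) (NegIdx (cmXV L dV hdV ι₁ v₁))
        (PosIdx (cmXW L dV dW hdW ι₁ v₁)) (NegIdx (cmXW L dV dW hdW ι₁ v₁)) finProdFinEquiv (cmEpsV L dV hdV ι₁ v₁)
        (cmEpsW L dV dW hdW ι₁ v₁)) (dualPairι (torusPlaceLetter L dV hdV dW hdW ι₁ v₁ u)) :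
          Matrix.unitaryGroup (Fin 6) ℂ) : Matrix (Fin 6) (Fin 6) ℂ))
        (placePoly L dV hdV dW hdW ι₁ datum m₁ m₂
          (fun b => ((printPlaces (InfinitePlace L) (kindOf L dV hdV dW hdW ι₁ datum) (lamOf L dV hdV dW hdW ι₁ datum)
            (lamOf_ne_zero L dV hdV dW hdW ι₁ datum) (pinnedVacs (kindOf L dV hdV dW hdW ι₁ datum) m₁ m₂)).loc b).φ) v₁) =
      (((torusPlaceCircles L v₁ u 0 : Circle) : ℂ) * ((torusPlaceCircles L v₁ u 1 : Circle) : ℂ)) •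
        placePoly L dV hdV dW hdW ι₁ datum m₁ m₂
          (fun b => ((printPlaces (InfinitePlace L) (kindOf L dV hdV dW hdW ι₁ datum) (lamOf L dV hdV dW hdW ι₁ datum)
            (lamOf_ne_zero L dV hdV dW hdW ι₁ datum) (pinnedVacs (kindOf L dV hdV dW hdW ι₁ datum) m₁ m₂)).loc b).φ) v₁ := by
  -- the place polynomial is `rename jI detZ = rename (pairFrame)⁻¹ (rename planeToDPIdx detZ)`
  have hj : (jI : HodgeCM.PerL34.Fock.PlaneVar → Fin 6) =
      (pairFrame (PosIdx (cmXV L dV hdV ι₁ v₁)) (NegIdx (cmXV L dV hdV ι₁ v₁)) (PosIdx (cmXW L dV dW hdW ι₁ v₁))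
        (NegIdx (cmXW L dV dW hdW ι₁ v₁)) finProdFinEquiv (cmEpsV L dV hdV ι₁ v₁) (cmEpsW L dV dW hdW ι₁ v₁)).symm ∘
        planeToDPIdx eA (posReadingEquiv hR) q₀ (NegIdx (cmXW L dV dW hdW ι₁ v₁)) := by
    funext x
    rw [Function.comp_apply, ← hjI x, Equiv.symm_apply_apply]
  have hP : placePoly L dV hdV dW hdW ι₁ datum m₁ m₂
      (fun b => ((printPlaces (InfinitePlace L) (kindOf L dV hdV dW hdW ι₁ datum) (lamOf L dV hdV dW hdW ι₁ datum)
        (lamOf_ne_zero L dV hdV dW hdW ι₁ datum) (pinnedVacs (kindOf L dV hdV dW hdW ι₁ datum) m₁ m₂)).loc b).φ) v₁ =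
      rename (pairFrame (PosIdx (cmXV L dV hdV ι₁ v₁)) (NegIdx (cmXV L dV hdV ι₁ v₁)) (PosIdx (cmXW L dV dW hdW ι₁ v₁))
        (NegIdx (cmXW L dV dW hdW ι₁ v₁)) finProdFinEquiv (cmEpsV L dV hdV ι₁ v₁) (cmEpsW L dV dW hdW ι₁ v₁)).symm
        (rename (planeToDPIdx eA (posReadingEquiv hR) q₀ (NegIdx (cmXW L dV dW hdW ι₁ v₁))) HodgeCM.PerL34.Fock.detZ) := by
    rw [placePoly_vacuum, hι, rename_rename]
    exact congrArg (fun j => rename j HodgeCM.PerL34.Fock.detZ) hj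
  rw [hP, linSubst_star_reindexUnitary_rename, torusPlaceLetter_eq_iotaTorusLetter L dV hdV dW hdW ι₁ v₁ hR u,
    linSubst_star_dualPairι_iota_rename_detZ, map_smul]

end Iota

/-! ## §3 The `S`-reading (`W_{ι₁}` read NEGATIVE): the twin dictionary and eigen-equation -/

section NegReading

variable {P' Q' R' S' : Type} [Fintype P'] [DecidableEq P'] [Fintype Q'] [DecidableEq Q'] [Fintype R'] [DecidableEq R']
  [Fintype S'] [DecidableEq S']
variable (eA : Fin 2 ≃ P') (eS : Fin 2 ≃ S') (q₀ : Q')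

/-- **the printed `ι₁` variables when `W` reads negative**: `z_{aj} ↦ (eA a, eS j)` (mixed block `P × S`), `w_j ↦ (q₀, eS j)` (same-sign block `Q × S`). -/
def planeToDPIdxS (R' : Type) : HodgeCM.PerL34.Fock.PlaneVar → DPIdx P' Q' R' S'
  | Sum.inl (a, j) => Sum.inr (Sum.inl (eA a, eS j))
  | Sum.inr j => Sum.inl (Sum.inr (q₀, eS j))

omit [Fintype P'] [DecidableEq P'] [Fintype Q'] [DecidableEq Q'] [Fintype R'] [DecidableEq R'] [Fintype S'] [DecidableEq S'] in
/-- (Ported verbatim from the HodgeCMPerL package; no docstring in the source.) -/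
@[simp] theorem planeToDPIdxS_z (a j : Fin 2) :
    planeToDPIdxS eA eS q₀ R' (Sum.inl (a, j)) = Sum.inr (Sum.inl (eA a, eS j)) := rfl

/-- **the `W`-torus letter at a negative-reading `ι₁`**: `((1,1),(1, diag(t₁,t₂)))`. -/
def iotaTorusLetterS (t : Circle × Circle) : DPK P' Q' R' S' := ((1, 1), (1, diagCircleUnitary eS t))

omit [Fintype Q'] [DecidableEq Q'] in
/-- `z_{aj} ↦ conj(t_j) z_{aj}` (mixed block: no conjugation in `dualPairι`, one in the substitution). [folklore] -/
theorem linSubst_star_dualPairι_iotaS_rename_z [Fintype Q'] [DecidableEq Q'] (t : Circle × Circle) (a j : Fin 2) :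
    linSubst (star ((dualPairι (iotaTorusLetterS eS t : DPK P' Q' R' S') : Matrix.unitaryGroup (DPIdx P' Q' R' S') ℂ) :
        Matrix (DPIdx P' Q' R' S') (DPIdx P' Q' R' S') ℂ)) (rename (planeToDPIdxS eA eS q₀ R') (HodgeCM.PerL34.Fock.z a j)) =
      C (star (((![t.1, t.2] j : Circle) : ℂ))) * rename (planeToDPIdxS eA eS q₀ R') (HodgeCM.PerL34.Fock.z a j) := by
  rw [HodgeCM.PerL34.Fock.z, rename_X, planeToDPIdxS_z, iotaTorusLetterS, linSubst_star_dualPairι_X_PS_general]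
  simp only [OneMemClass.coe_one, Matrix.one_apply, coe_diagCircleUnitary, Matrix.diagonal_apply, apply_ite star, star_one,
    star_zero, ite_mul, one_mul, zero_mul, mul_ite, mul_zero, apply_ite C, map_zero, Finset.sum_ite_eq', Finset.mem_univ, if_true,
    Equiv.symm_apply_apply]

omit [Fintype Q'] [DecidableEq Q'] in
/-- **the printed line transforms by `conj(t₁ t₂)`** under the negative-reading torus letter. [folklore] -/
theorem linSubst_star_dualPairι_iotaS_rename_detZ [Fintype Q'] [DecidableEq Q'] (t : Circle × Circle) :
    linSubst (star ((dualPairι (iotaTorusLetterS eS t : DPK P' Q' R' S') : Matrix.unitaryGroup (DPIdx P' Q' R' S') ℂ) :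
        Matrix (DPIdx P' Q' R' S') (DPIdx P' Q' R' S') ℂ)) (rename (planeToDPIdxS eA eS q₀ R') HodgeCM.PerL34.Fock.detZ) =
      (star ((t.1 : ℂ)) * star ((t.2 : ℂ))) • rename (planeToDPIdxS eA eS q₀ R') HodgeCM.PerL34.Fock.detZ := by
  simp only [HodgeCM.PerL34.Fock.detZ, map_sub, map_mul, linSubst_star_dualPairι_iotaS_rename_z, smul_eq_C_mul, map_mul,
    Matrix.cons_val_zero, Matrix.cons_val_one]
  ring

end NegReading

section IotaNeg

variable (L : Type) [Field L] [NumberField L] [IsCMField L]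
variable (dV : Fin 3 → L) (hdV : ∀ i, IsCMField.complexConj L (dV i) = dV i) (hdV0 : ∀ i, dV i ≠ 0)
variable (dW : Fin 2 → L) (hdW : ∀ i, IsCMField.complexConj L (dW i) = dW i) (hdW0 : ∀ i, dW i ≠ 0)
variable (ι₁ : L →+* ℂ)

/-- the frame `Fin 2 ≃ S_v` of a `W`-NEGATIVE reading (`∀ j, ¬ 0 < x_W j`). -/
def negReadingEquiv {x : Fin 2 → ℝ} (hS : ∀ j, ¬0 < x j) : Fin 2 ≃ NegIdx x := (Equiv.subtypeUnivEquiv hS).symm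

/-- (Ported verbatim from the HodgeCMPerL package; no docstring in the source.) -/
@[simp] theorem negReadingEquiv_symm_apply {x : Fin 2 → ℝ} (hS : ∀ j, ¬0 < x j) (s : NegIdx x) :
    (negReadingEquiv hS).symm s = s.1 := rfl

/-- **letter adapter, negative reading**: the torus letter of `TorusLetters` IS `iotaTorusLetterS` along `eS := negReadingEquiv hS`. -/
theorem torusPlaceLetter_eq_iotaTorusLetterS (v : {v : InfinitePlace ↥(maximalRealSubfield L) // v.IsReal})
    (hS : ∀ j, ¬0 < cmXW L dV dW hdW ι₁ v j) (u : SeesawArchTorus L) :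
    torusPlaceLetter L dV hdV dW hdW ι₁ v u =
      iotaTorusLetterS (P' := PosIdx (cmXV L dV hdV ι₁ v)) (Q' := NegIdx (cmXV L dV hdV ι₁ v)) (R' := PosIdx (cmXW L dV dW hdW ι₁ v))
        (negReadingEquiv hS) (torusPlaceCircles L v u 0, torusPlaceCircles L v u 1) := by
  haveI : IsEmpty (PosIdx (cmXW L dV dW hdW ι₁ v)) := ⟨fun r => hS r.1 r.2⟩
  refine Prod.ext (torusPlaceLetter_fst L dV hdV dW hdW ι₁ v u) (Prod.ext (Subsingleton.elim _ _) ?_)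
  rw [torusPlaceLetter_snd]
  apply Subtype.ext
  rw [coe_diagHom]
  change _ = ((diagCircleUnitary (negReadingEquiv hS) (torusPlaceCircles L v u 0, torusPlaceCircles L v u 1) :
      Matrix.unitaryGroup (NegIdx (cmXW L dV dW hdW ι₁ v)) ℂ) :
        Matrix (NegIdx (cmXW L dV dW hdW ι₁ v)) (NegIdx (cmXW L dV dW hdW ι₁ v)) ℂ)
  rw [coe_diagCircleUnitary]
  congr 1
  funext s
  rw [circleRestrict_apply, negReadingEquiv_symm_apply]
  rcases s with ⟨s, hs⟩
  fin_cases s <;> rfl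

variable (datum : ∀ b : InfinitePlace L, PlaceDatum L dV hdV dW hdW ι₁ (cmPlacesEquiv L b)) (m₁ m₂ : InfinitePlace L → ℤ)

/-- **the inserted `det z` at a `W`-negative `ι₁` place is a torus-letter eigenvector with eigenvalue `conj(c₀ c₁)`**, for the datum
`iota jI` with `jI = (pairFrame v₁)⁻¹ ∘ planeToDPIdxS eA eS q₀`. -/
theorem linSubst_torusLetter_placePoly_vacuum_iota_neg (v₁ : {v : InfinitePlace ↥(maximalRealSubfield L) // v.IsReal})
    (hS : ∀ j, ¬0 < cmXW L dV dW hdW ι₁ v₁ j) (eA : Fin 2 ≃ PosIdx (cmXV L dV hdV ι₁ v₁)) (q₀ : NegIdx (cmXV L dV hdV ι₁ v₁))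
    (jI : HodgeCM.PerL34.Fock.PlaneVar → Fin 6)
    (hjI : ∀ x, pairFrame (PosIdx (cmXV L dV hdV ι₁ v₁)) (NegIdx (cmXV L dV hdV ι₁ v₁)) (PosIdx (cmXW L dV dW hdW ι₁ v₁))
        (NegIdx (cmXW L dV dW hdW ι₁ v₁)) finProdFinEquiv (cmEpsV L dV hdV ι₁ v₁) (cmEpsW L dV dW hdW ι₁ v₁) (jI x) =
      planeToDPIdxS eA (negReadingEquiv hS) q₀ (PosIdx (cmXW L dV dW hdW ι₁ v₁)) x)
    (hι : datum ((cmPlacesEquiv L).symm v₁) = PlaceDatum.iota jI) (u : SeesawArchTorus L) :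
    linSubst (star ((reindexUnitary (pairFrame (PosIdx (cmXV L dV hdV ι₁ v₁)) (NegIdx (cmXV L dV hdV ι₁ v₁))
        (PosIdx (cmXW L dV dW hdW ι₁ v₁)) (NegIdx (cmXW L dV dW hdW ι₁ v₁)) finProdFinEquiv (cmEpsV L dV hdV ι₁ v₁)
        (cmEpsW L dV dW hdW ι₁ v₁)) (dualPairι (torusPlaceLetter L dV hdV dW hdW ι₁ v₁ u)) :
          Matrix.unitaryGroup (Fin 6) ℂ) : Matrix (Fin 6) (Fin 6) ℂ))
        (placePoly L dV hdV dW hdW ι₁ datum m₁ m₂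
          (fun b => ((printPlaces (InfinitePlace L) (kindOf L dV hdV dW hdW ι₁ datum) (lamOf L dV hdV dW hdW ι₁ datum)
            (lamOf_ne_zero L dV hdV dW hdW ι₁ datum) (pinnedVacs (kindOf L dV hdV dW hdW ι₁ datum) m₁ m₂)).loc b).φ) v₁) =
      (star ((torusPlaceCircles L v₁ u 0 : Circle) : ℂ) * star ((torusPlaceCircles L v₁ u 1 : Circle) : ℂ)) •
        placePoly L dV hdV dW hdW ι₁ datum m₁ m₂
          (fun b => ((printPlaces (InfinitePlace L) (kindOf L dV hdV dW hdW ι₁ datum) (lamOf L dV hdV dW hdW ι₁ datum)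
            (lamOf_ne_zero L dV hdV dW hdW ι₁ datum) (pinnedVacs (kindOf L dV hdV dW hdW ι₁ datum) m₁ m₂)).loc b).φ) v₁ := by
  have hj : (jI : HodgeCM.PerL34.Fock.PlaneVar → Fin 6) =
      (pairFrame (PosIdx (cmXV L dV hdV ι₁ v₁)) (NegIdx (cmXV L dV hdV ι₁ v₁)) (PosIdx (cmXW L dV dW hdW ι₁ v₁))
        (NegIdx (cmXW L dV dW hdW ι₁ v₁)) finProdFinEquiv (cmEpsV L dV hdV ι₁ v₁) (cmEpsW L dV dW hdW ι₁ v₁)).symm ∘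
        planeToDPIdxS eA (negReadingEquiv hS) q₀ (PosIdx (cmXW L dV dW hdW ι₁ v₁)) := by
    funext x
    rw [Function.comp_apply, ← hjI x, Equiv.symm_apply_apply]
  have hP : placePoly L dV hdV dW hdW ι₁ datum m₁ m₂
      (fun b => ((printPlaces (InfinitePlace L) (kindOf L dV hdV dW hdW ι₁ datum) (lamOf L dV hdV dW hdW ι₁ datum)
        (lamOf_ne_zero L dV hdV dW hdW ι₁ datum) (pinnedVacs (kindOf L dV hdV dW hdW ι₁ datum) m₁ m₂)).loc b).φ) v₁ =
      rename (pairFrame (PosIdx (cmXV L dV hdV ι₁ v₁)) (NegIdx (cmXV L dV hdV ι₁ v₁)) (PosIdx (cmXW L dV dW hdW ι₁ v₁))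
        (NegIdx (cmXW L dV dW hdW ι₁ v₁)) finProdFinEquiv (cmEpsV L dV hdV ι₁ v₁) (cmEpsW L dV dW hdW ι₁ v₁)).symm
        (rename (planeToDPIdxS eA (negReadingEquiv hS) q₀ (PosIdx (cmXW L dV dW hdW ι₁ v₁))) HodgeCM.PerL34.Fock.detZ) := by
    rw [placePoly_vacuum, hι, rename_rename]
    exact congrArg (fun j => rename j HodgeCM.PerL34.Fock.detZ) hj
  rw [hP, linSubst_star_reindexUnitary_rename, torusPlaceLetter_eq_iotaTorusLetterS L dV hdV dW hdW ι₁ v₁ hS u,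
    linSubst_star_dualPairι_iotaS_rename_detZ, map_smul]

end IotaNeg

end HodgeCM.Model.HypCensus

end
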